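import Literature.AlgebraicGeometry.Milne1999.WeilClassStabilizer
import Literature.AlgebraicGeometry.HodgeTheory.HodgeConjectureAbelianSubquotients
import HarnessLib

/-!
# `A^{M+1} × B^{N+1}` is a retract of `(A × B)^{K+1}` (`K ≥ M, N`); `B = D` and the Hodge conjecture descend from the powers of `A × B` to the mixed powers

Family `hodge`, layer `Literature/AlgebraicGeometry/HodgeTheory`. Research context: cell `pub-hodge-ring2`
(HONEST FRAMING: research route conditional on HC_CM; not a corollary; Q11.4-sentence-2 already refuted in
dim ≥ 3), Literature lane, programme R3 (R3-BD, mixed exponents). Elementary and UNCONDITIONAL; no named fact.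

## Statements

* `mixedPowersIncl M N K : A^{M+1} × B^{N+1} ⟶ (A × B)^{K+1}` (`r`-th component `(pr_{min(r,M)}, pr_{min(r,N)})`)
  and `mixedPowersProj M N K : (A × B)^{K+1} ⟶ A^{M+1} × B^{N+1}` (`((pr₁ ∘ pr_i)_{i ≤ M}, (pr₂ ∘ pr_j)_{j ≤ N})`)
  for `M, N ≤ K`, with **`mixedPowersIncl_comp_mixedPowersProj : incl ≫ proj = 𝟙`** (Mumford §19:
  `Hom(C, A × B) = Hom(C, A) ⊕ Hom(C, B)`; the universal maps `powLift`/`powProj` of `Milne1999/WeilClassStabilizer`);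
* **`IsDivisorGenerated.powSucc_prod_powSucc_of_prod_powSucc`**: `B = D` for `(A × B)^{K+1}` implies `B = D` for
  `A^{M+1} × B^{N+1}` (`IsDivisorGenerated.of_comp_eq_nsmul_id`, van Geemen §2.4–2.5 / Lemma 3.7);
* **`HodgeConjectureFor.powSucc_prod_powSucc_of_prod_powSucc`**: the same for the Hodge conjecture.

## References

* [MumfordAV1970] D. Mumford, *Abelian Varieties*, §19. [cite: MumfordAV1970, §19 (Hom(C, A × B) = Hom(C, A) ⊕ Hom(C, B))]
* [vanGeemen1994HodgeAV] B. van Geemen, LNM 1594 (1994), §2.4–2.5 and Lemma 3.7.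
  [cite: vanGeemen1994HodgeAV, §2.4–2.5 (p. 235) and §3.6–3.7 (p. 236)]
-/

noncomputable section

open CategoryTheory

namespace Literature.AlgebraicGeometry.HodgeTheory

open Literature.AlgebraicGeometry.Motives Literature.AlgebraicGeometry.Milne1999

section Retract

universe u

variable {k : Type u} [Field k] {A B : AbelianVariety k}

/-- `r ↦ min(r, M) : Fin (K+1) → Fin (M+1)`. [folklore] -/
private def clampFin (M K : ℕ) (r : Fin (K + 1)) : Fin (M + 1) :=
  ⟨min r M, by omega⟩

/-- `clamp ∘ castLE = id`. [folklore] -/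
private theorem clampFin_castLE {M K : ℕ} (hMK : M ≤ K) (i : Fin (M + 1)) :
    clampFin M K (i.castLE (by omega)) = i := by
  ext
  simp only [clampFin, Fin.val_castLE]
  have := i.2
  omega

variable (A B) in
/-- **`A^{M+1} × B^{N+1} ⟶ (A × B)^{K+1}`**, `r`-th component `(pr_{min(r,M)}, pr_{min(r,N)})`.
[cite: MumfordAV1970, §19 (Hom(C, A × B) = Hom(C, A) ⊕ Hom(C, B))] -/
def mixedPowersIncl (M N K : ℕ) : (A.powSucc M).prod (B.powSucc N) ⟶ (A.prod B).powSucc K :=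
  powLift K fun r => AbelianVariety.prodLift
    (AbelianVariety.fst (A.powSucc M) (B.powSucc N) ≫ powProj A M (clampFin M K r))
    (AbelianVariety.snd (A.powSucc M) (B.powSucc N) ≫ powProj B N (clampFin N K r))

variable (A B) in
/-- **`(A × B)^{K+1} ⟶ A^{M+1} × B^{N+1}`** (`M, N ≤ K`): `((pr₁ ∘ pr_i)_{i ≤ M}, (pr₂ ∘ pr_j)_{j ≤ N})`.
[cite: MumfordAV1970, §19 (Hom(C, A × B) = Hom(C, A) ⊕ Hom(C, B))] -/
def mixedPowersProj (M N K : ℕ) (hM : M ≤ K) (hN : N ≤ K) :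
    (A.prod B).powSucc K ⟶ (A.powSucc M).prod (B.powSucc N) :=
  AbelianVariety.prodLift
    (powLift M fun i => powProj (A.prod B) K (i.castLE (by omega)) ≫ AbelianVariety.fst A B)
    (powLift N fun j => powProj (A.prod B) K (j.castLE (by omega)) ≫ AbelianVariety.snd A B)

/-- **`A^{M+1} × B^{N+1}` is a retract of `(A × B)^{K+1}`**: `incl ≫ proj = 𝟙`.
[cite: MumfordAV1970, §19 (Hom(C, A × B) = Hom(C, A) ⊕ Hom(C, B))] -/
theorem mixedPowersIncl_comp_mixedPowersProj (M N K : ℕ) (hM : M ≤ K) (hN : N ≤ K) :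
    mixedPowersIncl A B M N K ≫ mixedPowersProj A B M N K hM hN = 𝟙 _ := by
  apply AbelianVariety.prod_hom_ext
  · rw [Category.assoc, mixedPowersProj, AbelianVariety.prodLift_fst, Category.id_comp]
    refine pow_hom_ext M fun i => ?_
    rw [Category.assoc, powLift_powProj, ← Category.assoc, mixedPowersIncl, powLift_powProj,
      AbelianVariety.prodLift_fst, clampFin_castLE hM]
  · rw [Category.assoc, mixedPowersProj, AbelianVariety.prodLift_snd, Category.id_comp]
    refine pow_hom_ext N fun j => ?_
    rw [Category.assoc, powLift_powProj, ← Category.assoc, mixedPowersIncl, powLift_powProj,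
      AbelianVariety.prodLift_snd, clampFin_castLE hN]

end Retract

section Descent

variable {A B : AbelianVariety ℂ}

/-- **`B = D` descends from `(A × B)^{K+1}` to `A^{M+1} × B^{N+1}`** (`M, N ≤ K`; a retract:
`IsDivisorGenerated.of_comp_eq_nsmul_id` with `n = 1`). [cite: vanGeemen1994HodgeAV, §2.4–2.5 (p. 235) and §3.6–3.7 (p. 236)] -/
theorem IsDivisorGenerated.powSucc_prod_powSucc_of_prod_powSucc {M N K : ℕ} (hM : M ≤ K) (hN : N ≤ K)
    (h : IsDivisorGenerated ((A.prod B).powSucc K)) :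
    IsDivisorGenerated ((A.powSucc M).prod (B.powSucc N)) :=
  IsDivisorGenerated.of_comp_eq_nsmul_id (mixedPowersIncl A B M N K) (mixedPowersProj A B M N K hM hN)
    one_ne_zero (by rw [mixedPowersIncl_comp_mixedPowersProj, one_smul]) h

/-- **The Hodge conjecture descends from `(A × B)^{K+1}` to `A^{M+1} × B^{N+1}`** (`M, N ≤ K`).
[cite: vanGeemen1994HodgeAV, §3.6–3.7 Lemma 3.7 (p. 236)] -/
theorem HodgeConjectureFor.powSucc_prod_powSucc_of_prod_powSucc {M N K : ℕ} (hM : M ≤ K) (hN : N ≤ K)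
    (h : HodgeConjectureFor ((A.prod B).powSucc K).dim ((A.prod B).powSucc K).X) :
    HodgeConjectureFor ((A.powSucc M).prod (B.powSucc N)).dim ((A.powSucc M).prod (B.powSucc N)).X :=
  HodgeConjectureFor.of_comp_eq_nsmul_id (mixedPowersIncl A B M N K) (mixedPowersProj A B M N K hM hN)
    one_ne_zero (by rw [mixedPowersIncl_comp_mixedPowersProj, one_smul]) h

/-- `B = D` for all mixed powers `A^{M+1} × B^{N+1}` from `B = D` for all powers of `A × B`.
[cite: vanGeemen1994HodgeAV, §2.4–2.5 (p. 235) and §3.6–3.7 (p. 236)] -/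
theorem IsDivisorGenerated.powSucc_prod_powSucc_of_forall_prod_powSucc
    (h : ∀ K, IsDivisorGenerated ((A.prod B).powSucc K)) (M N : ℕ) :
    IsDivisorGenerated ((A.powSucc M).prod (B.powSucc N)) :=
  (h (max M N)).powSucc_prod_powSucc_of_prod_powSucc (le_max_left M N) (le_max_right M N)

end Descent

end Literature.AlgebraicGeometry.HodgeTheory

end
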